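import Literature.MathematicalPhysics.QuantumLattice.SegmentParallelTransport
import Literature.MathematicalPhysics.QuantumLattice.YangMillsClassicalGaugeProofs
import Literature.MathematicalPhysics.QuantumLattice.YangMillsHeatFlowProofs
import Mathlib.MeasureTheory.Integral.IntervalIntegral.FundThmCalculus
import HarnessLib

/-!
# The connection in the exponential gauge: radiality and the Fock–Schwinger formula

QuantumLattice support file (everything proved; one definition with body, no named facts) on the
proof path of `Literature.MathematicalPhysics.QuantumLattice.Waldron2019_yangMillsFlow_flatTorus`
(A. Waldron, Invent. math. 217 (2019)), Lemma 3.5 / §4 (good gauges). With the exponential gauge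
transformation `g = expGauge c A` of `SegmentParallelTransport` and the tree's gauge action
(`gaugeAct`, acting by `h = g⁻¹`), the gauged connection `Ã = g⁻¹ A g + g⁻¹ dg` satisfies:

* `expGaugeUnit`, `contDiff_expGaugeUnit_inv` — `g⁻¹` as a `C^n` field of units;
* `expConn c A = gaugeAct (g⁻¹) A` and `expConn_apply` — `Ã(x)(v) = g⁻¹ A(x)(v) g + g⁻¹ ∂ᵥg`;
* `expConn_radial` — **radial gauge**: `Ã(x)(x − c) = 0`;
* `curvature_expConn` — `F_Ã = g⁻¹ F_A g` (tree: `curvature_gaugeAct_holds`);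
* `expConn_eq_integral_curvature` — **Fock–Schwinger**:
  `Ã(c + y)(v) = ∫₀¹ τ • F_Ã(c + τ y)(y, v) dτ` for `A ∈ C³`;
* `norm_expConn_le` — hence `‖Ã(c + y)(v)‖ ≤ ½ sup_{τ ∈ [0,1]} ‖F_Ã(c + τy)(y, v)‖`.

References: A. Waldron, Invent. math. 217 (2019), §3–§4 [Waldron2019]; K. Uhlenbeck, Comm.
Math. Phys. 83 (1982), §2 (exponential gauge) [folklore].
-/

noncomputable section

open Set Metric Filter MeasureTheory intervalIntegral
open scoped Topology

namespace Literature.MathematicalPhysics.QuantumLattice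

universe u

section ExpConn

variable {E : Type u} [NormedAddCommGroup E] [InnerProductSpace ℝ E] [CompleteSpace E]
variable {𝔸 : Type u} [NormedRing 𝔸] [NormedAlgebra ℝ 𝔸] [CompleteSpace 𝔸]

/-- The exponential gauge transformation as a field of units. [folklore] -/
def expGaugeUnit {A : Connection E 𝔸} (hA : ContDiff ℝ 1 A) (c : E) (x : E) : 𝔸ˣ :=
  (isUnit_expGauge hA c x).unit

/-- Unfolding lemma. [folklore] -/
@[simp] theorem val_expGaugeUnit {A : Connection E 𝔸} (hA : ContDiff ℝ 1 A) (c x : E) :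
    (expGaugeUnit hA c x : 𝔸) = expGauge c A x := rfl

/-- `x ↦ (g x)⁻¹` is `C^n` (inversion is smooth on units). [folklore] -/
theorem contDiff_expGaugeUnit_inv {n : ℕ∞} (hn : 1 ≤ n) {A : Connection E 𝔸} (hA : ContDiff ℝ n A)
    (c : E) :
    ContDiff ℝ n fun x => (((expGaugeUnit (hA.of_le (by exact_mod_cast hn)) c x)⁻¹ : 𝔸ˣ) : 𝔸) := by
  have hA1 : ContDiff ℝ 1 A := hA.of_le (by exact_mod_cast hn)
  have hg : ContDiff ℝ n (expGauge c A) := contDiff_expGauge hn hA c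
  have heq : (fun x => (((expGaugeUnit hA1 c x)⁻¹ : 𝔸ˣ) : 𝔸)) = fun x => Ring.inverse (expGauge c A x) := by
    funext x
    rw [← val_expGaugeUnit hA1 c x, Ring.inverse_unit]
  rw [heq]
  rw [contDiff_iff_contDiffAt]
  intro x
  have h1 : ContDiffAt ℝ n Ring.inverse (expGauge c A x) := by
    have := contDiffAt_ringInverse ℝ (n := n) (expGaugeUnit hA1 c x)
    simpa using this
  exact h1.comp x hg.contDiffAt

/-- **The connection in the exponential gauge**: `Ã = gaugeAct (g⁻¹) A`. [folklore] -/
def expConn {A : Connection E 𝔸} (hA : ContDiff ℝ 1 A) (c : E) : Connection E 𝔸 :=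
  gaugeAct (fun x => (expGaugeUnit hA c x)⁻¹) A

/-- `Ã(x)(v) = g(x)⁻¹ A(x)(v) g(x) + g(x)⁻¹ ∂ᵥ g(x)`. [folklore] -/
theorem expConn_apply {A : Connection E 𝔸} (hA : ContDiff ℝ 1 A) (c x v : E) :
    expConn hA c x v = (((expGaugeUnit hA c x)⁻¹ : 𝔸ˣ) : 𝔸) * A x v * expGauge c A x +
      (((expGaugeUnit hA c x)⁻¹ : 𝔸ˣ) : 𝔸) * fderiv ℝ (expGauge c A) x v := by
  have hg : Differentiable ℝ (expGauge c A) := (contDiff_expGauge le_rfl hA c).differentiable (by simp)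
  -- derivative of the inverse: `∂ᵥ(g⁻¹) = −g⁻¹ (∂ᵥ g) g⁻¹`
  have hinv : fderiv ℝ (fun y => (((expGaugeUnit hA c y)⁻¹ : 𝔸ˣ) : 𝔸)) x v =
      -((((expGaugeUnit hA c x)⁻¹ : 𝔸ˣ) : 𝔸) * fderiv ℝ (expGauge c A) x v *
        (((expGaugeUnit hA c x)⁻¹ : 𝔸ˣ) : 𝔸)) := by
    have heq : (fun y => (((expGaugeUnit hA c y)⁻¹ : 𝔸ˣ) : 𝔸)) = fun y => Ring.inverse (expGauge c A y) := by
      funext y; rw [← val_expGaugeUnit hA c y, Ring.inverse_unit]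
    rw [heq]
    have h1 : HasFDerivAt (𝕜 := ℝ) Ring.inverse
        (-ContinuousLinearMap.mulLeftRight ℝ 𝔸 (((expGaugeUnit hA c x)⁻¹ : 𝔸ˣ) : 𝔸)
          (((expGaugeUnit hA c x)⁻¹ : 𝔸ˣ) : 𝔸)) (expGauge c A x) :=
      hasFDerivAt_ringInverse (expGaugeUnit hA c x)
    have h2 : HasFDerivAt (fun y => Ring.inverse (expGauge c A y))
        ((-ContinuousLinearMap.mulLeftRight ℝ 𝔸 (((expGaugeUnit hA c x)⁻¹ : 𝔸ˣ) : 𝔸)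
          (((expGaugeUnit hA c x)⁻¹ : 𝔸ˣ) : 𝔸)).comp (fderiv ℝ (expGauge c A) x)) x :=
      h1.comp x (hg x).hasFDerivAt
    rw [h2.fderiv]
    simp
  have hu : (((expGaugeUnit hA c x)⁻¹ : 𝔸ˣ) : 𝔸) * expGauge c A x = 1 := Units.inv_mul _
  rw [expConn, gaugeAct_apply, hinv, inv_inv]
  simp only [val_expGaugeUnit]
  rw [show -((((expGaugeUnit hA c x)⁻¹ : 𝔸ˣ) : 𝔸) * fderiv ℝ (expGauge c A) x v *
      (((expGaugeUnit hA c x)⁻¹ : 𝔸ˣ) : 𝔸)) * expGauge c A x =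
      -((((expGaugeUnit hA c x)⁻¹ : 𝔸ˣ) : 𝔸) * fderiv ℝ (expGauge c A) x v) by
    rw [neg_mul, mul_assoc, hu, mul_one]]
  noncomm_ring

/-- **Radial gauge**: `Ã(x)(x − c) = 0`. [folklore] -/
theorem expConn_radial {A : Connection E 𝔸} (hA : ContDiff ℝ 1 A) (c x : E) :
    expConn hA c x (x - c) = 0 := by
  rw [expConn_apply, fderiv_expGauge_radial hA c x]
  noncomm_ring

/-- **Gauge covariance of the curvature**: `F_Ã(x)(u,v) = g⁻¹ F_A(x)(u,v) g` for `A ∈ C²`.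
[folklore] -/
theorem curvature_expConn {A : Connection E 𝔸} (hA : ContDiff ℝ 2 A) (c x u v : E) :
    curvature (expConn (hA.of_le (by norm_num)) c) x u v =
      (((expGaugeUnit (hA.of_le (by norm_num)) c x)⁻¹ : 𝔸ˣ) : 𝔸) * curvature A x u v *
        expGauge c A x := by
  have hA1 : ContDiff ℝ 1 A := hA.of_le (by norm_num)
  have hinv := contDiff_expGaugeUnit_inv (n := 2) (by norm_num) hA c
  have h := curvature_gaugeAct_holds (E := E) (𝔸 := 𝔸) (fun y => (expGaugeUnit hA1 c y)⁻¹) A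
    hinv (hA.differentiable two_ne_zero) x u v
  rw [expConn, h, inv_inv]
  rfl

/-- **Smoothness of the gauged connection**: `Ã ∈ C¹` for `A ∈ C²`. [folklore] -/
theorem contDiff_expConn {A : Connection E 𝔸} (hA : ContDiff ℝ 2 A) (c : E) :
    ContDiff ℝ 1 (expConn (hA.of_le (by norm_num)) c) := by
  have hA1 : ContDiff ℝ 1 A := hA.of_le (by norm_num)
  have hinv2 : ContDiff ℝ 2 fun x => (((expGaugeUnit hA1 c x)⁻¹ : 𝔸ˣ) : 𝔸) :=
    contDiff_expGaugeUnit_inv (n := 2) (by norm_num) hA c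
  have hinv1 : ContDiff ℝ 1 fun x => (((expGaugeUnit hA1 c x)⁻¹ : 𝔸ˣ) : 𝔸) := hinv2.of_le (by norm_num)
  have hg1 : ContDiff ℝ 1 (expGauge c A) := (contDiff_expGauge (n := 2) (by norm_num) hA c).of_le (by norm_num)
  -- `(h x)⁻¹⁻¹ = g x`
  have hval : ∀ x, ((((expGaugeUnit hA1 c x)⁻¹)⁻¹ : 𝔸ˣ) : 𝔸) = expGauge c A x := fun x => by
    rw [inv_inv]; rfl
  have h1 : ContDiff ℝ 1 fun x => ContinuousLinearMap.mulLeftRight ℝ 𝔸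
      ((((expGaugeUnit hA1 c x)⁻¹ : 𝔸ˣ) : 𝔸)) ((((expGaugeUnit hA1 c x)⁻¹)⁻¹ : 𝔸ˣ) : 𝔸) := by
    simp_rw [hval]
    exact ((ContinuousLinearMap.mulLeftRight ℝ 𝔸).contDiff.comp hinv1).clm_apply hg1
  have h2 : ContDiff ℝ 1 fun x => ContinuousLinearMap.mulLeftRight ℝ 𝔸 (1 : 𝔸)
      ((((expGaugeUnit hA1 c x)⁻¹)⁻¹ : 𝔸ˣ) : 𝔸) := by
    simp_rw [hval]
    exact ((ContinuousLinearMap.mulLeftRight ℝ 𝔸).contDiff.comp contDiff_const).clm_apply hg1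
  have h3 : ContDiff ℝ 1 (fderiv ℝ fun y => (((expGaugeUnit hA1 c y)⁻¹ : 𝔸ˣ) : 𝔸)) :=
    hinv2.fderiv_right (m := 1) (by norm_num)
  unfold expConn gaugeAct
  exact (h1.clm_comp hA1).sub (h2.clm_comp h3)

/-- **The linearized radial identity**: `Ã(c + w)(v) = −(∂ᵥÃ)(c + w)(w)`, obtained by
differentiating `Ã(c + w)(w) = 0` in the direction `v` (`A ∈ C²`). [folklore] -/
theorem expConn_apply_eq_neg_fderiv {A : Connection E 𝔸} (hA : ContDiff ℝ 2 A) (c w v : E) :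
    expConn (hA.of_le (by norm_num)) c (c + w) v =
      -(fderiv ℝ (expConn (hA.of_le (by norm_num)) c) (c + w) v w) := by
  have hA1 : ContDiff ℝ 1 A := hA.of_le (by norm_num)
  have hÃd : Differentiable ℝ (expConn hA1 c) := (contDiff_expConn hA c).differentiable (by simp)
  -- `R w' = Ã(c + w')(w') ≡ 0`
  have hR : (fun w' : E => expConn hA1 c (c + w') w') = fun _ => 0 :=
    funext fun w' => by simpa using expConn_radial hA1 c (c + w')
  have hC : DifferentiableAt ℝ (fun w' : E => expConn hA1 c (c + w')) w :=
    (hÃd (c + w)).comp w ((differentiableAt_const c).add differentiableAt_id)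
  have hchain : fderiv ℝ (fun w' : E => expConn hA1 c (c + w')) w = fderiv ℝ (expConn hA1 c) (c + w) := by
    have h : HasFDerivAt (fun w' : E => expConn hA1 c (c + w'))
        ((fderiv ℝ (expConn hA1 c) (c + w)).comp (ContinuousLinearMap.id ℝ E)) w :=
      (hÃd (c + w)).hasFDerivAt.comp w ((hasFDerivAt_id w).const_add c)
    rw [h.fderiv, ContinuousLinearMap.comp_id]
  have hD : fderiv ℝ (fun w' : E => expConn hA1 c (c + w') w') w v =
      expConn hA1 c (c + w) v + fderiv ℝ (expConn hA1 c) (c + w) v w := by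
    rw [fderiv_clm_apply (u := fun w' => w') hC differentiableAt_id]
    simp only [FunLike.coe_add, Pi.add_apply, ContinuousLinearMap.comp_apply,
      ContinuousLinearMap.flip_apply, hchain]
    first
      | rfl
      | simp
  rw [hR] at hD
  simp only [fderiv_fun_const, Pi.zero_apply, FunLike.coe_zero] at hD
  rw [eq_neg_iff_add_eq_zero]
  exact hD.symm

/-- **The Fock–Schwinger formula**: in the exponential gauge,
`At(c + y)(v) = ∫₀¹ τ • F_At(c + τ y)(y, v) dτ` (`A ∈ C²`). [folklore] -/
theorem expConn_eq_integral_curvature {A : Connection E 𝔸} (hA : ContDiff ℝ 2 A) (c y v : E) :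
    expConn (hA.of_le (by norm_num)) c (c + y) v =
      ∫ τ in (0 : ℝ)..1, τ • curvature (expConn (hA.of_le (by norm_num)) c) (c + τ • y) y v := by
  have hA1 : ContDiff ℝ 1 A := hA.of_le (by norm_num)
  set At : Connection E 𝔸 := expConn hA1 c with hAt
  have hAt1 : ContDiff ℝ 1 At := contDiff_expConn hA c
  have hAtd : Differentiable ℝ At := hAt1.differentiable (by simp)
  -- the ray and the components of `At` along it
  have hγ : ∀ τ : ℝ, HasDerivAt (fun σ : ℝ => c + σ • y) y τ := fun τ => by
    simpa using ((hasDerivAt_id τ).smul_const y).const_add c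
  have hGv : ∀ τ : ℝ, HasDerivAt (fun σ : ℝ => At (c + σ • y) v)
      (fderiv ℝ (fun z => At z v) (c + τ • y) y) τ := by
    intro τ
    have hd : DifferentiableAt ℝ (fun z => At z v) (c + τ • y) := (hAtd _).clm_apply (differentiableAt_const v)
    exact hd.hasFDerivAt.comp_hasDerivAt τ (hγ τ)
  -- `φ(τ) = τ • At(c + τy)(v)` and its derivative
  have hφ : ∀ τ : ℝ, HasDerivAt (fun σ : ℝ => σ • At (c + σ • y) v)
      (At (c + τ • y) v + τ • fderiv ℝ (fun z => At z v) (c + τ • y) y) τ := by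
    intro τ
    have h : HasDerivAt (fun σ : ℝ => σ • At (c + σ • y) v)
        (τ • fderiv ℝ (fun z => At z v) (c + τ • y) y + (1 : ℝ) • At (c + τ • y) v) τ :=
      (hasDerivAt_id' τ).smul (hGv τ)
    simpa [add_comm] using h
  -- rewrite the derivative through the curvature, using the linearized radial identity
  have hkey : ∀ τ : ℝ, At (c + τ • y) v + τ • fderiv ℝ (fun z => At z v) (c + τ • y) y =
      τ • curvature At (c + τ • y) y v := by
    intro τ
    have h1 : At (c + τ • y) v = -(fderiv ℝ At (c + τ • y) v (τ • y)) :=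
      expConn_apply_eq_neg_fderiv hA c (τ • y) v
    have h2 : fderiv ℝ At (c + τ • y) v (τ • y) = τ • fderiv ℝ (fun z => At z y) (c + τ • y) v := by
      rw [map_smul, fderiv_clm_apply (hAtd _) (differentiableAt_const y)]
      simp
    have hbr : τ • ⁅At (c + τ • y) y, At (c + τ • y) v⁆ = 0 := by
      have hrad : At (c + τ • y) (τ • y) = 0 := by
        have h := expConn_radial hA1 c (c + τ • y)
        rwa [add_sub_cancel_left] at h
      have hsm : τ • At (c + τ • y) y = At (c + τ • y) (τ • y) := by rw [map_smul]
      rw [Ring.lie_def, smul_sub, ← smul_mul_assoc, ← mul_smul_comm, hsm, hrad]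
      simp
    rw [curvature, smul_add, smul_sub, hbr, add_zero, h1, h2]
    abel
  -- ### the fundamental theorem of calculus on `[0, 1]`
  have hderiv : ∀ τ ∈ uIcc (0 : ℝ) 1, HasDerivAt (fun σ : ℝ => σ • At (c + σ • y) v)
      (τ • curvature At (c + τ • y) y v) τ := fun τ _ => (hφ τ).congr_deriv (hkey τ)
  have hcont : Continuous fun τ : ℝ => τ • curvature At (c + τ • y) y v := by
    have hF : Continuous fun z => curvature At z y v :=
      (contDiff_curvature_apply (k := 0) (by simpa using hAt1) y v).continuous
    exact continuous_id.smul (hF.comp (continuous_const.add (continuous_id.smul continuous_const)))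
  have hFTC := integral_eq_sub_of_hasDerivAt hderiv (hcont.intervalIntegrable _ _)
  simp only [one_smul, zero_smul] at hFTC
  rw [hFTC]
  simp

/-- **The Fock–Schwinger bound**: if `‖F_Ã(c + τ y)(y, v)‖ ≤ M` for `τ ∈ [0, 1]`, then
`‖Ã(c + y)(v)‖ ≤ M/2`. [folklore] -/
theorem norm_expConn_le {A : Connection E 𝔸} (hA : ContDiff ℝ 2 A) (c y v : E) {M : ℝ}
    (hM : ∀ τ ∈ Icc (0 : ℝ) 1, ‖curvature (expConn (hA.of_le (by norm_num)) c) (c + τ • y) y v‖ ≤ M) :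
    ‖expConn (hA.of_le (by norm_num)) c (c + y) v‖ ≤ M / 2 := by
  have hA1 : ContDiff ℝ 1 A := hA.of_le (by norm_num)
  have hM0 : 0 ≤ M := (norm_nonneg _).trans (hM 0 ⟨le_rfl, zero_le_one⟩)
  rw [expConn_eq_integral_curvature hA c y v]
  have hAt1 : ContDiff ℝ 1 (expConn hA1 c) := contDiff_expConn hA c
  have hF : Continuous fun z => curvature (expConn hA1 c) z y v :=
    (contDiff_curvature_apply (k := 0) (by simpa using hAt1) y v).continuous
  have hcont : Continuous fun τ : ℝ => τ • curvature (expConn hA1 c) (c + τ • y) y v :=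
    continuous_id.smul (hF.comp (continuous_const.add (continuous_id.smul continuous_const)))
  calc ‖∫ τ in (0 : ℝ)..1, τ • curvature (expConn hA1 c) (c + τ • y) y v‖
      ≤ ∫ τ in (0 : ℝ)..1, ‖τ • curvature (expConn hA1 c) (c + τ • y) y v‖ :=
        norm_integral_le_integral_norm zero_le_one
    _ ≤ ∫ τ in (0 : ℝ)..1, τ * M := by
        refine intervalIntegral.integral_mono_on zero_le_one (hcont.norm.intervalIntegrable _ _)
          ((continuous_id.mul continuous_const).intervalIntegrable _ _) fun τ hτ => ?_
        rw [norm_smul, Real.norm_eq_abs, abs_of_nonneg hτ.1]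
        exact mul_le_mul_of_nonneg_left (hM τ hτ) hτ.1
    _ = M / 2 := by
        rw [intervalIntegral.integral_mul_const, integral_id]; ring

end ExpConn


end Literature.MathematicalPhysics.QuantumLattice
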